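import Summits.MatrixMultiplication.MatrixMultiplication.Theorems.SoloInformedCyclicModel

/-!
# Cyclic model: gauge-free forms (Lemma B (B3) of §8.4d)

This work, §8.4d. The cellwise sign changes `a(i,j) ↦ −a(i,j)` (and likewise for `b`, `c`) are
symmetries of the cyclic model; on paper one "gauges" a popular level set to a common value. Here the
gauge is typed instead: `eqn_norm` absorbs the signs of the `a`- and `c`-cell into the pattern, and
`sign_rigidity_pm` is the sign-rigidity engine of Lemma B with the rows only required to share sign
CLASSES. References: this work §8.4d; CohnUmans2013 (arXiv:1207.6528) Def. 12.
-/

namespace Summit.MatrixMultiplication.MatrixMultiplication.Theorems.TwistedTPP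

namespace CyclicModel

variable {G S : Type*} [AddCommGroup G] [AddCommGroup S] (R : CyclicModel G S)

/-- **Normalised triangle equation**: with `a i j = ±x` and `c k i = ±y` the equation `E(i,j,k)` reads
`x ± b j k ± y = 0` (the cell signs are absorbed into the pattern; this is the gauge freedom, typed). -/
theorem eqn_norm {i j k : G} {x y : S} (hx : pm (R.a i j) x) (hy : pm (R.c k i) y) :
    x + R.b j k + y = 0 ∨ x + R.b j k - y = 0 ∨ x - R.b j k + y = 0 ∨ x - R.b j k - y = 0 := by
  unfold pm at hx hy
  rcases R.eqn i j k with h | h | h | h <;> rcases hx with e | e <;> rcases hy with f | f <;>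
    first
    | exact Or.inl (by linear_combination (norm := abel1) h - e - f)
    | exact Or.inl (by linear_combination (norm := abel1) - h + e + f)
    | exact Or.inr (Or.inl (by linear_combination (norm := abel1) h - e + f))
    | exact Or.inr (Or.inl (by linear_combination (norm := abel1) - h + e - f))
    | exact Or.inr (Or.inr (Or.inl (by linear_combination (norm := abel1) h - e - f)))
    | exact Or.inr (Or.inr (Or.inl (by linear_combination (norm := abel1) - h + e + f)))
    | exact Or.inr (Or.inr (Or.inr (by linear_combination (norm := abel1) h - e + f)))
    | exact Or.inr (Or.inr (Or.inr (by linear_combination (norm := abel1) - h + e - f)))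
    | exact Or.inl (by linear_combination (norm := abel1) h - e + f)
    | exact Or.inl (by linear_combination (norm := abel1) - h + e - f)
    | exact Or.inr (Or.inl (by linear_combination (norm := abel1) h - e - f))
    | exact Or.inr (Or.inl (by linear_combination (norm := abel1) - h + e + f))
    | exact Or.inr (Or.inr (Or.inl (by linear_combination (norm := abel1) h - e + f)))
    | exact Or.inr (Or.inr (Or.inl (by linear_combination (norm := abel1) - h + e - f)))
    | exact Or.inr (Or.inr (Or.inr (by linear_combination (norm := abel1) h - e - f)))
    | exact Or.inr (Or.inr (Or.inr (by linear_combination (norm := abel1) - h + e + f)))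

/-- **Sign rigidity, gauge-free form** (Lemma B (B3), §8.4d): as `sign_rigidity`, with the two rows only
required to carry the same sign CLASS `|αj|` in column `j`. -/
theorem sign_rigidity_pm (h2 : ∀ x y : S, x + x = y + y → x = y) {i i' j k : G} {α αj l : S}
    (ha : pm (R.a i j) αj) (ha' : pm (R.a i' j) αj)
    (hci : pm (R.c k i) (α + l)) (hci' : pm (R.c k i') (α - l)) :
    l = 0 ∨ α = 0 ∨ pm αj α ∨ pm l αj := by
  unfold pm
  have e := R.eqn_norm ha hci
  have e' := R.eqn_norm ha' hci'
  rcases e with e | e | e | e <;> rcases e' with e' | e' | e' | e' <;>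
    first
    | (left; apply h2; rw [add_zero]; linear_combination (norm := abel1) e - e')
    | (left; apply h2; rw [add_zero]; linear_combination (norm := abel1) e' - e)
    | (left; apply h2; rw [add_zero]; linear_combination (norm := abel1) e + e')
    | (left; apply h2; rw [add_zero]; linear_combination (norm := abel1) - e - e')
    | (right; left; apply h2; rw [add_zero]; linear_combination (norm := abel1) e - e')
    | (right; left; apply h2; rw [add_zero]; linear_combination (norm := abel1) e' - e)
    | (right; left; apply h2; rw [add_zero]; linear_combination (norm := abel1) e + e')
    | (right; left; apply h2; rw [add_zero]; linear_combination (norm := abel1) - e - e')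
    | (right; right; left; left; apply h2; linear_combination (norm := abel1) e - e')
    | (right; right; left; left; apply h2; linear_combination (norm := abel1) e' - e)
    | (right; right; left; left; apply h2; linear_combination (norm := abel1) e + e')
    | (right; right; left; left; apply h2; linear_combination (norm := abel1) - e - e')
    | (right; right; left; right; apply h2; linear_combination (norm := abel1) e - e')
    | (right; right; left; right; apply h2; linear_combination (norm := abel1) e' - e)
    | (right; right; left; right; apply h2; linear_combination (norm := abel1) e + e')
    | (right; right; left; right; apply h2; linear_combination (norm := abel1) - e - e')
    | (right; right; right; left; apply h2; linear_combination (norm := abel1) e - e')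
    | (right; right; right; left; apply h2; linear_combination (norm := abel1) e' - e)
    | (right; right; right; left; apply h2; linear_combination (norm := abel1) e + e')
    | (right; right; right; left; apply h2; linear_combination (norm := abel1) - e - e')
    | (right; right; right; right; apply h2; linear_combination (norm := abel1) e - e')
    | (right; right; right; right; apply h2; linear_combination (norm := abel1) e' - e)
    | (right; right; right; right; apply h2; linear_combination (norm := abel1) e + e')


/-- **`j`-lazy `b` forces injective `c`-classes** (the lazy-row lemma after the symmetry T∘ρ, §8.4d):
if every column of `b` is constant in `j` up to sign, then all `n²` sign classes of `c` are distinct.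
This is the exact form of branch (R3)(ii) of Theorem 8.8: a non-degenerate base column whose twisted
levels all sit at `t = 0` forces `b(j,k) = ±b(j₀,k)` everywhere, hence rank `≥ n²`. -/
theorem c_injective_of_b_jlazy (hb : ∀ j j' k : G, pm (R.b j k) (R.b j' k)) {k i k' i' : G}
    (hpm : pm (R.c k i) (R.c k' i')) : k = k' ∧ i = i' := by
  by_contra hne
  -- read `E(i', 0, k')`, move the `b`-cell to row `j₂` and the `c`-cell to `(k, i)`: a mixed sum on
  -- the two distinct triples `(i', 0, k')`, `(i, j₂, k)` of one fibre vanishes, contradicting (Sep)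
  set j₂ : G := i' + k' - i - k with hj₂
  obtain ⟨h1, h2, h3, h4⟩ := R.sep i' 0 k' i j₂ k (by rw [hj₂]; abel)
    (by intro h; simp only [Prod.mk.injEq] at h; exact hne ⟨h.2.2.symm, h.1.symm⟩)
  have f := hb 0 j₂ k'
  unfold pm at f hpm
  rcases R.eqn i' 0 k' with e | e | e | e <;> rcases f with f | f <;> rcases hpm with g | g <;>
    first
    | (apply h1; linear_combination (norm := abel1) e + f + g)
    | (apply h1; linear_combination (norm := abel1) e + f - g)
    | (apply h1; linear_combination (norm := abel1) e - f + g)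
    | (apply h1; linear_combination (norm := abel1) e - f - g)
    | (apply h2; linear_combination (norm := abel1) e + f + g)
    | (apply h2; linear_combination (norm := abel1) e + f - g)
    | (apply h2; linear_combination (norm := abel1) e - f + g)
    | (apply h2; linear_combination (norm := abel1) e - f - g)
    | (apply h3; linear_combination (norm := abel1) e + f + g)
    | (apply h3; linear_combination (norm := abel1) e + f - g)
    | (apply h3; linear_combination (norm := abel1) e - f + g)
    | (apply h3; linear_combination (norm := abel1) e - f - g)
    | (apply h4; linear_combination (norm := abel1) e + f + g)
    | (apply h4; linear_combination (norm := abel1) e + f - g)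
    | (apply h4; linear_combination (norm := abel1) e - f + g)
    | (apply h4; linear_combination (norm := abel1) e - f - g)

end CyclicModel

end Summit.MatrixMultiplication.MatrixMultiplication.Theorems.TwistedTPP
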